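import Literature.Barriers.QuantumAdvantage.BoundedEntanglementConfigs
import Literature.Computability.QuantumComplexity.CircuitEmbedding
import Literature.Computability.Cryptography.QubitRegisterProofs
import HarnessLib

/-!
# Reduced states of a pure register state as Gram data: merge, gate, partial trace, split test

Topic `Literature/Barriers/QuantumAdvantage`; third file of the proof programme for the named
fact `Literature.Barriers.QuantumAdvantage.jozsaLinden2003_pblocked` (Jozsa–Linden 2003, §3).
The classical simulation of lemma `ratpbl` keeps, block by block, the *state of the block*, and
re-blocks after a straddling gate by "comput[ing] the reduced state `ρ_X` of every subset
`X ⊆ B₁ ∪ B₂` … and compar[ing] the global state of `B₁ ∪ B₂` with `ρ_{X₁} ⊗ ⋯ ⊗ ρ_{X_K}`"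
(proof of lemma `ratpbl`, Case 2). For an (unnormalised) amplitude vector `c : QReg N → ℂ` and
a wire set `B` the reduced state of `B` is, up to the factor `‖c‖²`, the **Gram datum**

  `gram B c x y = ∑_{r ∈ cfg Bᶜ} c (x|_B, r) · conj (c (y|_B, r))`   (`= ‖c‖² ρ_B (x|_B, y|_B)`),

a function of the `B`-parts of `x`, `y` only (`gram_congr`). These data are *canonical* (no phase
or scalar ambiguity, unlike block amplitude vectors), which is what keeps the numbers of the
simulation intrinsic. This file proves the exact update rules the simulator implements:

* `sum_cfg_gram_self`, `exists_gram_self_ne_zero` — the diagonal sums to `‖c‖²`; a nonzero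
  vector has a nonzero diagonal entry on every wire set;
* **merge** `gram_mul_gram`: if `S` splits `c` and `T` is disjoint from `S`, then
  `gram S ⋆ gram T = gram (S ∪ T) · ‖c‖²` pointwise (`ρ_{S∪T} = ρ_S ⊗ ρ_T`);
* **gate inside** `gram_placeGate_mulVec_of_subset`: for an operator placed on wires inside `C`,
  `gram C (U_E c) = U · gram C c · U†` entrywise (`ρ_C ↦ U ρ_C U†`);
* **gate outside** `gram_placeGate_mulVec_of_disjoint`: a *unitary* placed off `B` does not
  change `gram B` (`ρ_B` unchanged);
* **partial trace** `gram_eq_sum_gram`: for `A ⊆ C`, `gram A` is the sum of `gram C` over the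
  configurations of `C \ A` (`ρ_A = tr_{C∖A} ρ_C`);
* **split test on a column** `splits_iff_column_mul_eq`: if `C` splits `c` and
  `gram C c y₀ y₀ ≠ 0`, then for `S ⊆ C` the state splits across `S` iff the column
  `u = gram C c · y₀` (a nonzero multiple of the `C`-factor of `c`) satisfies the rank-one
  identities of `BoundedEntanglementSplitting.splits_iff_mul_eq` — the "equality of states"
  searched for in Case 2, in exact arithmetic and without square roots;
* `sum_ite_mul_conj_eq_sum_cfg_gram` — the probability of reading `1` on a wire of `B` is read
  off the diagonal of `gram B` ("identify the block containing the leftmost qubit, compute the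
  probability distribution").

## References

* R. Jozsa, N. Linden, *On the role of entanglement in quantum-computational speed-up*, Proc. R.
  Soc. Lond. A 459 (2003) 2011–2032, arXiv:quant-ph/0201143: §3, proof of lemma `ratpbl`
  (Cases 1, 2 and the final sampling step).
* M. A. Nielsen, I. L. Chuang, *Quantum Computation and Quantum Information*, CUP 2010, §2.4.3
  (reduced density operator and partial trace; `ρ_{AB} = ρ_A ⊗ ρ_B` for product states;
  local unitaries), §2.1.6 (unitaries preserve inner products), §2.5 (Schmidt rank one).
-/

noncomputable section

namespace Literature.Barriers.QuantumAdvantage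

open Finset Matrix ComplexConjugate Literature.Computability.Cryptography
  Literature.Computability.QuantumComplexity

variable {N k : ℕ}

/-! ### Norm and Gram data -/

/-- The squared norm `⟨c|c⟩ = ∑_w c w · conj (c w)` as a complex number. [cite: NielsenChuang2010, §2.1.4] -/
def cnormSq (c : QReg N → ℂ) : ℂ := ∑ w, c w * conj (c w)

/-- `cnormSq` is the (real) squared norm `normSq` of the register library. [cite: NielsenChuang2010, §2.1.4] -/
theorem cnormSq_eq_normSq (c : QReg N → ℂ) : cnormSq c = (normSq c : ℂ) := by
  unfold cnormSq normSq
  push_cast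
  exact sum_congr rfl fun w _ => Complex.mul_conj' (c w)

/-- A vector with vanishing squared norm is zero. [folklore] -/
theorem eq_zero_of_cnormSq_eq_zero {c : QReg N → ℂ} (h : cnormSq c = 0) : c = 0 := by
  rw [cnormSq_eq_normSq] at h
  have h' : normSq c = 0 := by exact_mod_cast h
  unfold normSq at h'
  rw [Finset.sum_eq_zero_iff_of_nonneg fun _ _ => by positivity] at h'
  funext w
  simpa using h' w (mem_univ w)

/-- The slice of `c` along the wires of `B` at `v`: `w ↦ c (v|_B, w|_{Bᶜ})`. [folklore] -/
def slice (B : Finset (Fin N)) (c : QReg N → ℂ) (v : QReg N) : QReg N → ℂ :=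
  fun w => c (B.piecewise v w)

/-- Value of a slice (definitional). [folklore] -/
@[simp] theorem slice_apply (B : Finset (Fin N)) (c : QReg N → ℂ) (v w : QReg N) :
    slice B c v w = c (B.piecewise v w) := rfl

/-- **Gram datum of a wire set.** `gram B c x y = ∑_{r ∈ cfg Bᶜ} c (x|_B, r) · conj (c (y|_B, r))`:
for a unit vector `c` this is the matrix element `⟨x|_B| ρ_B |y|_B⟩` of the reduced density
operator of the qubits in `B`; in general it is `‖c‖²` times it.
[cite: NielsenChuang2010, §2.4.3 (reduced density operator, eq. (2.178))] -/
def gram (B : Finset (Fin N)) (c : QReg N → ℂ) (x y : QReg N) : ℂ :=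
  ∑ r ∈ cfg Bᶜ, c (B.piecewise x r) * conj (c (B.piecewise y r))

variable {B S T C A : Finset (Fin N)} {c : QReg N → ℂ}

/-- The Gram datum only sees the `B`-parts of its arguments. [cite: NielsenChuang2010, §2.4.3] -/
theorem gram_congr {x x' y y' : QReg N} (hx : ∀ i ∈ B, x i = x' i) (hy : ∀ i ∈ B, y i = y' i) :
    gram B c x y = gram B c x' y' := by
  unfold gram
  refine sum_congr rfl fun r _ => ?_
  rw [B.piecewise_congr hx (fun _ _ => rfl), B.piecewise_congr hy (fun _ _ => rfl)]

/-- Hermitian symmetry: `gram B c y x = conj (gram B c x y)`. [cite: NielsenChuang2010, §2.4.3] -/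
theorem gram_conj (x y : QReg N) : conj (gram B c x y) = gram B c y x := by
  unfold gram
  rw [map_sum]
  exact sum_congr rfl fun r _ => by rw [map_mul, Complex.conj_conj, mul_comm]

/-- Diagonal entries are sums of squared moduli. [cite: NielsenChuang2010, §2.4.3] -/
theorem gram_self (y : QReg N) :
    gram B c y y = ∑ r ∈ cfg Bᶜ, ((‖c (B.piecewise y r)‖ ^ 2 : ℝ) : ℂ) := by
  unfold gram
  exact sum_congr rfl fun r _ => by rw [Complex.mul_conj']; norm_cast

/-- **The diagonal of the Gram datum sums to `‖c‖²`** (the trace of `‖c‖² ρ_B`).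
[cite: NielsenChuang2010, §2.4.3 (tr ρ_B = 1)] -/
theorem sum_cfg_gram_self (B : Finset (Fin N)) (c : QReg N → ℂ) :
    ∑ y ∈ cfg B, gram B c y y = cnormSq c := by
  unfold gram cnormSq
  rw [sum_eq_sum_cfg_sum_cfg B (fun w => c w * conj (c w)), Finset.sum_comm]

/-- A nonzero vector has a nonzero diagonal Gram entry on every wire set (used to pick the column
on which the split test is run). [folklore] -/
theorem exists_gram_self_ne_zero (B : Finset (Fin N)) (hc : c ≠ 0) :
    ∃ y ∈ cfg B, gram B c y y ≠ 0 := by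
  by_contra h
  push Not at h
  exact hc (eq_zero_of_cnormSq_eq_zero (by rw [← sum_cfg_gram_self B c]; exact sum_eq_zero h))

/-! ### Merge: the reduced state of a union with a splitting part is the tensor product -/

/-- **Merge rule.** If `S` splits `c` and `T` is disjoint from `S`, then pointwise
`gram S c x y · gram T c x y = gram (S ∪ T) c x y · ‖c‖²`, i.e. `ρ_{S ∪ T} = ρ_S ⊗ ρ_T`
(only `S` needs to split). Proof: the rank-one identity of `S` turns the summand over
`(r, r') ∈ cfg Sᶜ × cfg Tᶜ` into `c (x|_{S∪T}, u) conj c (y|_{S∪T}, u) · |c (s, r)|²` under the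
bijection `r' ↦ (s, u) = (r'|_S, r'|_{(S∪T)ᶜ})`. This is the step "amalgamating the two block
labels" read backwards, and the data of Case 2 before the gate acts.
[cite: JozsaLinden2003, §3 (proof of lemma ratpbl, Case 2)] -/
theorem gram_mul_gram (hS : Splits c S) (hST : Disjoint S T) (x y : QReg N) :
    gram S c x y * gram T c x y = gram (S ∪ T) c x y * cnormSq c := by
  have hSZ : S ⊆ Tᶜ := fun i hi => mem_compl.2 (Finset.disjoint_left.1 hST hi)
  have key : ∀ v r s u : QReg N, c (S.piecewise v r) * c (T.piecewise v (S.piecewise s u)) =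
      c ((S ∪ T).piecewise v u) * c (S.piecewise s r) := by
    intro v r s u
    have h := hS.mul_eq (S.piecewise v r) (T.piecewise v (S.piecewise s u))
    rwa [piecewise_piecewise_piecewise_eq_piecewise_union, piecewise_union_piecewise_right,
      piecewise_piecewise_piecewise_of_disjoint hST] at h
  calc gram S c x y * gram T c x y
      = ∑ r ∈ cfg Sᶜ, ∑ r' ∈ cfg Tᶜ, (c (S.piecewise x r) * conj (c (S.piecewise y r))) *
          (c (T.piecewise x r') * conj (c (T.piecewise y r'))) := by
        unfold gram
        rw [Finset.sum_mul_sum]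
    _ = ∑ r ∈ cfg Sᶜ, ∑ s ∈ cfg S, ∑ u ∈ cfg (S ∪ T)ᶜ,
          (c ((S ∪ T).piecewise x u) * conj (c ((S ∪ T).piecewise y u))) *
            (c (S.piecewise s r) * conj (c (S.piecewise s r))) := by
        refine sum_congr rfl fun r _ => ?_
        rw [sum_cfg_eq_sum_sum hSZ, compl_sdiff_eq_compl_union]
        refine sum_congr rfl fun s _ => sum_congr rfl fun u _ => ?_
        have h1 := key x r s u
        have h2 := congrArg conj (key y r s u)
        rw [map_mul, map_mul] at h2
        calc c (S.piecewise x r) * conj (c (S.piecewise y r)) *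
              (c (T.piecewise x (S.piecewise s u)) * conj (c (T.piecewise y (S.piecewise s u))))
            = (c (S.piecewise x r) * c (T.piecewise x (S.piecewise s u))) *
                (conj (c (S.piecewise y r)) * conj (c (T.piecewise y (S.piecewise s u)))) := by ring
          _ = (c ((S ∪ T).piecewise x u) * c (S.piecewise s r)) *
                (conj (c ((S ∪ T).piecewise y u)) * conj (c (S.piecewise s r))) := by rw [h1, h2]
          _ = _ := by ring
    _ = (∑ u ∈ cfg (S ∪ T)ᶜ, c ((S ∪ T).piecewise x u) * conj (c ((S ∪ T).piecewise y u))) *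
          ∑ r ∈ cfg Sᶜ, ∑ s ∈ cfg S, c (S.piecewise s r) * conj (c (S.piecewise s r)) := by
        rw [Finset.mul_sum]
        refine sum_congr rfl fun r _ => ?_
        rw [Finset.mul_sum]
        refine sum_congr rfl fun s _ => ?_
        rw [Finset.sum_mul]
    _ = gram (S ∪ T) c x y * cnormSq c := by
        unfold gram cnormSq
        rw [sum_eq_sum_cfg_sum_cfg S (fun w => c w * conj (c w))]

/-- Merge rule, solved for the union (for `c ≠ 0`): `gram (S ∪ T) = gram S ⋆ gram T / ‖c‖²`.
[cite: JozsaLinden2003, §3 (proof of lemma ratpbl, Case 2)] -/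
theorem gram_union_eq_div (hS : Splits c S) (hST : Disjoint S T) (hc : c ≠ 0) (x y : QReg N) :
    gram (S ∪ T) c x y = gram S c x y * gram T c x y / cnormSq c := by
  have hn : cnormSq c ≠ 0 := fun h => hc (eq_zero_of_cnormSq_eq_zero h)
  rw [gram_mul_gram hS hST, mul_div_cancel_right₀ _ hn]

/-! ### Gates: inside a wire set they conjugate its Gram datum, outside they do nothing -/

/-- Overwriting along wires inside `C` commutes with gluing along `C`. [folklore] -/
theorem extend_piecewise_of_subset (E : Fin k ↪ Fin N) (hE : ∀ j, E j ∈ C) (v r : QReg N)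
    (z : QReg k) : Function.extend E z (C.piecewise v r) = C.piecewise (Function.extend E z v) r := by
  funext i
  by_cases hi : i ∈ Set.range E
  · obtain ⟨j, rfl⟩ := hi
    rw [E.injective.extend_apply, piecewise_eq_of_mem _ _ _ (hE j), E.injective.extend_apply]
  · rw [extend_apply_of_not_mem E z _ hi]
    by_cases hiC : i ∈ C
    · rw [piecewise_eq_of_mem _ _ _ hiC, piecewise_eq_of_mem _ _ _ hiC,
        extend_apply_of_not_mem E z _ hi]
    · rw [piecewise_eq_of_notMem _ _ _ hiC, piecewise_eq_of_notMem _ _ _ hiC]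

/-- Overwriting along wires outside `B` commutes with gluing along `B`. [folklore] -/
theorem extend_piecewise_of_disjoint (E : Fin k ↪ Fin N) (hE : ∀ j, E j ∉ B) (v r : QReg N)
    (z : QReg k) : Function.extend E z (B.piecewise v r) = B.piecewise v (Function.extend E z r) := by
  funext i
  by_cases hi : i ∈ Set.range E
  · obtain ⟨j, rfl⟩ := hi
    rw [E.injective.extend_apply, piecewise_eq_of_notMem _ _ _ (hE j), E.injective.extend_apply]
  · rw [extend_apply_of_not_mem E z _ hi]
    by_cases hiB : i ∈ B
    · rw [piecewise_eq_of_mem _ _ _ hiB, piecewise_eq_of_mem _ _ _ hiB]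
    · rw [piecewise_eq_of_notMem _ _ _ hiB, piecewise_eq_of_notMem _ _ _ hiB,
        extend_apply_of_not_mem E z _ hi]

/-- **Gate inside.** For an operator `U` placed on wires inside `C`,
`gram C (U_E c) x y = ∑_{z, z'} U (x|_E, z) conj (U (y|_E, z')) · gram C c (x[E ↦ z]) (y[E ↦ z'])`,
the entrywise form of `ρ_C ↦ U ρ_C U†` — the update "applying the unitary matrix of size at
most `2^{2p} × 2^{2p}`" of Cases 1 and 2 on the canonical data (no unitarity needed).
[cite: JozsaLinden2003, §3 (proof of lemma ratpbl, Cases 1 and 2)] -/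
theorem gram_placeGate_mulVec_of_subset (E : Fin k ↪ Fin N) (hE : ∀ j, E j ∈ C)
    (U : Matrix (QReg k) (QReg k) ℂ) (c : QReg N → ℂ) (x y : QReg N) :
    gram C (placeGate E U *ᵥ c) x y =
      ∑ z : QReg k, ∑ z' : QReg k, U (x ∘ E) z * conj (U (y ∘ E) z') *
        gram C c (Function.extend E z x) (Function.extend E z' y) := by
  have hcomp : ∀ v r : QReg N, (C.piecewise v r) ∘ E = v ∘ E := fun v r =>
    funext fun j => piecewise_eq_of_mem _ _ _ (hE j)
  unfold gram
  simp_rw [placeGate_mulVec_apply, hcomp, extend_piecewise_of_subset E hE, map_sum, map_mul,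
    Finset.sum_mul_sum]
  rw [Finset.sum_comm]
  refine sum_congr rfl fun z _ => ?_
  rw [Finset.sum_comm]
  refine sum_congr rfl fun z' _ => ?_
  rw [Finset.mul_sum]
  exact sum_congr rfl fun r _ => by ring

/-- The sesquilinear pairing `⟨φ|ψ⟩` is invariant under a placed unitary. [cite: NielsenChuang2010, §2.1.6] -/
theorem star_dotProduct_placeGate_mulVec (E : Fin k ↪ Fin N) {U : Matrix (QReg k) (QReg k) ℂ}
    (hU : U ∈ Matrix.unitaryGroup (QReg k) ℂ) (φ ψ : QReg N → ℂ) :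
    star (placeGate E U *ᵥ φ) ⬝ᵥ (placeGate E U *ᵥ ψ) = star φ ⬝ᵥ ψ := by
  have hMU := placeGate_mem_unitaryGroup_holds E hU
  rw [Matrix.star_mulVec, ← Matrix.dotProduct_mulVec, Matrix.mulVec_mulVec,
    ← star_eq_conjTranspose, Matrix.mem_unitaryGroup_iff'.1 hMU, Matrix.one_mulVec]

/-- A placed operator off `B` acts slice by slice: `(U_E c)(v|_B, r) = (U_E (slice B c v)) r`. [folklore] -/
theorem placeGate_mulVec_piecewise_of_disjoint (E : Fin k ↪ Fin N) (hE : ∀ j, E j ∉ B)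
    (U : Matrix (QReg k) (QReg k) ℂ) (c : QReg N → ℂ) (v r : QReg N) :
    (placeGate E U *ᵥ c) (B.piecewise v r) = (placeGate E U *ᵥ slice B c v) r := by
  have hcomp : (B.piecewise v r) ∘ E = r ∘ E := funext fun j => piecewise_eq_of_notMem _ _ _ (hE j)
  rw [placeGate_mulVec_apply, placeGate_mulVec_apply]
  refine sum_congr rfl fun z _ => ?_
  rw [hcomp, extend_piecewise_of_disjoint E hE, slice_apply]

/-- … and the result is blind to the `B`-part of the outer configuration. [folklore] -/
theorem placeGate_mulVec_slice_piecewise (E : Fin k ↪ Fin N) (hE : ∀ j, E j ∉ B)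
    (U : Matrix (QReg k) (QReg k) ℂ) (c : QReg N → ℂ) (v s r : QReg N) :
    (placeGate E U *ᵥ slice B c v) (B.piecewise s r) = (placeGate E U *ᵥ slice B c v) r := by
  have hcomp : (B.piecewise s r) ∘ E = r ∘ E := funext fun j => piecewise_eq_of_notMem _ _ _ (hE j)
  rw [placeGate_mulVec_apply, placeGate_mulVec_apply]
  refine sum_congr rfl fun z _ => ?_
  rw [hcomp, extend_piecewise_of_disjoint E hE, slice_apply, slice_apply,
    Finset.piecewise_idem_right]

/-- **Gate outside.** A *unitary* placed on wires off `B` leaves `gram B` unchanged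
(`ρ_B` is invariant under unitaries on the other qubits): `#cfg B · gram B` is the pairing of
two slices, which the unitary preserves. This is why the untouched blocks of the description
keep their data. [cite: JozsaLinden2003, §3 (proof of lemma ratpbl, Cases 1 and 2)] -/
theorem gram_placeGate_mulVec_of_disjoint (E : Fin k ↪ Fin N) (hE : ∀ j, E j ∉ B)
    {U : Matrix (QReg k) (QReg k) ℂ} (hU : U ∈ Matrix.unitaryGroup (QReg k) ℂ)
    (c : QReg N → ℂ) (x y : QReg N) : gram B (placeGate E U *ᵥ c) x y = gram B c x y := by
  have hL : ((cfg B).card : ℂ) * gram B (placeGate E U *ᵥ c) x y =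
      star (placeGate E U *ᵥ slice B c y) ⬝ᵥ (placeGate E U *ᵥ slice B c x) := by
    rw [dotProduct, sum_eq_card_cfg_smul_sum_cfg B
      (fun w => (star (placeGate E U *ᵥ slice B c y)) w * (placeGate E U *ᵥ slice B c x) w)
      (fun s r => by
        simp only [Pi.star_apply]
        rw [placeGate_mulVec_slice_piecewise E hE, placeGate_mulVec_slice_piecewise E hE]),
      nsmul_eq_mul]
    congr 1
    unfold gram
    refine sum_congr rfl fun r _ => ?_
    rw [placeGate_mulVec_piecewise_of_disjoint E hE, placeGate_mulVec_piecewise_of_disjoint E hE,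
      Pi.star_apply, Complex.star_def, mul_comm]
  have hR : ((cfg B).card : ℂ) * gram B c x y = star (slice B c y) ⬝ᵥ slice B c x := by
    rw [dotProduct, sum_eq_card_cfg_smul_sum_cfg B
      (fun w => (star (slice B c y)) w * slice B c x w)
      (fun s r => by simp only [Pi.star_apply, slice_apply, Finset.piecewise_idem_right]),
      nsmul_eq_mul]
    congr 1
    unfold gram
    refine sum_congr rfl fun r _ => ?_
    rw [Pi.star_apply, Complex.star_def, slice_apply, slice_apply, mul_comm]
  have h := hL.trans ((star_dotProduct_placeGate_mulVec E hU _ _).trans hR.symm)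
  exact mul_left_cancel₀ (Nat.cast_ne_zero.2 (card_cfg_pos B).ne') h

/-! ### Partial trace -/

/-- **Partial trace.** For `A ⊆ C`, `gram A c x y = ∑_{t ∈ cfg (C ∖ A)} gram C c (t ∪ x|…) (t ∪ y|…)`:
the Gram datum of `A` is the sum of the `C`-data over a common configuration `t` of `C \ A`
glued onto both arguments (`ρ_A = tr_{C∖A} ρ_C`) — how the data of the newly found blocks are
read off after re-blocking. [cite: JozsaLinden2003, §3 (proof of lemma ratpbl, Case 2: "compute the reduced state ρ_X of every subset X ⊆ B₁ ∪ B₂")] -/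
theorem gram_eq_sum_gram (hAC : A ⊆ C) (c : QReg N → ℂ) (x y : QReg N) :
    gram A c x y = ∑ t ∈ cfg (C \ A), gram C c ((C \ A).piecewise t x) ((C \ A).piecewise t y) := by
  unfold gram
  rw [sum_cfg_eq_sum_sum (show C \ A ⊆ Aᶜ from fun i hi => mem_compl.2 (mem_sdiff.1 hi).2),
    compl_sdiff_sdiff_eq hAC]
  refine sum_congr rfl fun t _ => sum_congr rfl fun r _ => ?_
  rw [piecewise_piecewise_sdiff_eq hAC x t r, piecewise_piecewise_sdiff_eq hAC y t r]

/-! ### The split test on a column of the Gram datum -/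

/-- The Gram datum of a splitting set factorises through its factor: if `c = v · g` with `v`
depending on `C` and `g` on `Cᶜ`, then `gram C c x y = v x · conj (v y) · ∑_{r ∈ cfg Cᶜ} |g r|²`
(`ρ_C` is the pure state `v`, up to normalisation). [cite: NielsenChuang2010, §2.4.3 (ρ_A of a product state)] -/
theorem gram_eq_of_factor {v g : QReg N → ℂ} (hc : ∀ w, c w = v w * g w) (hv : DependsOn v (C : Set (Fin N)))
    (hg : DependsOn g (↑C : Set (Fin N))ᶜ) (x y : QReg N) :
    gram C c x y = v x * conj (v y) * ∑ r ∈ cfg Cᶜ, g r * conj (g r) := by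
  unfold gram
  rw [Finset.mul_sum]
  refine sum_congr rfl fun r _ => ?_
  have hv' : ∀ z : QReg N, v (C.piecewise z r) = v z := fun z =>
    hv fun _ hi => piecewise_eq_of_mem _ _ _ hi
  have hg' : ∀ z : QReg N, g (C.piecewise z r) = g r := fun z =>
    hg fun _ hi => piecewise_eq_of_notMem _ _ _ hi
  rw [hc, hc, hv', hv', hg', hg', map_mul]
  ring

/-- Gluing along `S ⊆ C` two configurations that share their part off `C`. [folklore] -/
theorem piecewise_piecewise_piecewise_of_subset (hS : S ⊆ C) (x y r : QReg N) :
    S.piecewise (C.piecewise x r) (C.piecewise y r) = C.piecewise (S.piecewise x y) r := by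
  funext i
  by_cases hiS : i ∈ S
  · have hiC := hS hiS
    simp [Finset.piecewise, hiS, hiC]
  · by_cases hiC : i ∈ C <;> simp [Finset.piecewise, hiS, hiC]

/-- **The split test.** Let `C` split `c` and let `y₀` be a configuration with
`gram C c y₀ y₀ ≠ 0`; put `u x = gram C c x y₀` (a nonzero multiple of the `C`-factor of `c`).
Then for every `S ⊆ C`: `c` splits across `(S, Sᶜ)` iff `u x · u y = u (x|_S, y) · u (y|_S, x)`
for all `x`, `y`. This decides "the new block structure within the qubits of `B₁ ∪ B₂`" from the
canonical data by finitely many exact multiplications.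
[cite: JozsaLinden2003, §3 (proof of lemma ratpbl, Case 2: "looking for an equality of states")] -/
theorem splits_iff_column_mul_eq (hC : Splits c C) {y₀ : QReg N} (hy₀ : gram C c y₀ y₀ ≠ 0)
    (hS : S ⊆ C) :
    Splits c S ↔ ∀ x y, gram C c x y₀ * gram C c y y₀ =
      gram C c (S.piecewise x y) y₀ * gram C c (S.piecewise y x) y₀ := by
  obtain ⟨v, g, hv, hg, hc⟩ := hC
  have hgram : ∀ x y, gram C c x y = v x * conj (v y) * ∑ r ∈ cfg Cᶜ, g r * conj (g r) :=
    gram_eq_of_factor hc hv hg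
  have hGne : (∑ r ∈ cfg Cᶜ, g r * conj (g r)) ≠ 0 := by
    intro h
    apply hy₀
    rw [hgram, h, mul_zero]
  have hvy₀ : v y₀ ≠ 0 := by
    intro h
    apply hy₀
    rw [hgram, h, zero_mul, zero_mul]
  have hκ : conj (v y₀) * ∑ r ∈ cfg Cᶜ, g r * conj (g r) ≠ 0 :=
    mul_ne_zero ((map_ne_zero (starRingEnd ℂ)).2 hvy₀) hGne
  have hu : ∀ x, gram C c x y₀ = v x * (conj (v y₀) * ∑ r ∈ cfg Cᶜ, g r * conj (g r)) :=
    fun x => by rw [hgram, mul_assoc]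
  constructor
  · intro hSc x y
    obtain ⟨r₀, -, hr₀⟩ := Finset.exists_ne_zero_of_sum_ne_zero hGne
    have hg₀ : g r₀ ≠ 0 := fun h => hr₀ (by rw [h, zero_mul])
    have e1 : ∀ z : QReg N, c (C.piecewise z r₀) = v z * g r₀ := fun z => by
      rw [hc, hv (fun _ hi => piecewise_eq_of_mem _ _ _ hi),
        hg (x := C.piecewise z r₀) (y := r₀) (fun _ hi => piecewise_eq_of_notMem _ _ _ hi)]
    have hid := hSc.mul_eq (C.piecewise x r₀) (C.piecewise y r₀)
    rw [piecewise_piecewise_piecewise_of_subset hS, piecewise_piecewise_piecewise_of_subset hS,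
      e1, e1, e1, e1] at hid
    have hv2 : v x * v y = v (S.piecewise x y) * v (S.piecewise y x) :=
      mul_right_cancel₀ (pow_ne_zero 2 hg₀) (by linear_combination hid)
    rw [hu, hu, hu, hu]
    linear_combination (conj (v y₀) * ∑ r ∈ cfg Cᶜ, g r * conj (g r)) ^ 2 * hv2
  · intro h
    have hv2 : ∀ x y, v x * v y = v (S.piecewise x y) * v (S.piecewise y x) := by
      intro x y
      have h' := h x y
      rw [hu, hu, hu, hu] at h'
      exact mul_right_cancel₀ (pow_ne_zero 2 hκ) (by linear_combination h')
    obtain ⟨a, b, ha, hb, hab⟩ := splits_of_mul_eq hv2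
    refine ⟨a, fun w => b w * g w, ha, ?_, fun w => by rw [hc, hab]; ring⟩
    intro w w' hww'
    change b w * g w = b w' * g w'
    rw [hb hww', hg (fun i hi => hww' i fun hiS => hi (hS hiS))]

/-! ### Reading a one-wire probability off the diagonal -/

/-- **Born weights of one wire from the block containing it**: for `i₀ ∈ B`,
`∑_{y : y i₀ = 1} c y conj (c y) = ∑_{x ∈ cfg B, x i₀ = 1} gram B c x x` — "identify the block
containing the leftmost qubit, compute the probability distribution".
[cite: JozsaLinden2003, §3 (proof of lemma ratpbl, final step)] -/
theorem sum_ite_mul_conj_eq_sum_cfg_gram {i₀ : Fin N} (hi₀ : i₀ ∈ B) (c : QReg N → ℂ) :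
    (∑ y : QReg N, if y i₀ = true then c y * conj (c y) else 0) =
      ∑ x ∈ cfg B, if x i₀ = true then gram B c x x else 0 := by
  rw [sum_eq_sum_cfg_sum_cfg B, Finset.sum_comm]
  refine sum_congr rfl fun s _ => ?_
  have hpw : ∀ r : QReg N, (B.piecewise s r) i₀ = s i₀ := fun r => piecewise_eq_of_mem _ _ _ hi₀
  simp_rw [hpw]
  unfold gram
  by_cases h : s i₀ = true <;> simp [h]

end Literature.Barriers.QuantumAdvantage

end
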